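import Mathlib
import Literature.MathematicalPhysics.QuantumFieldTheory.Balaban1983to89.Beta.BubbleTransfer
import Literature.MathematicalPhysics.QuantumFieldTheory.Balaban1983to89.Beta.SquareTable

/-!
# Road «FP» (binder row D1), leaf N7a″ — RE-LEGGING an abstract bubble table: same continuum data, new lattice legs

The cell's composed-road END (`ComposedRoad.oneLoopDrift_of_composedLegInterfacePow_identity`, instantiated for road FP in
`FP/AsymptoticEnd.hasym_of_legInterface`) takes an abstract table of `BubbleTransfer.Leg`s.  A `Leg` bundles a lattice leg
`f`, its continuum part `ℓ` of degree `a` and size `A`, and an error constant `B` with `|f L k w − ℓ w| ≤ B/‖w‖^{a+1}`.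
The END's value hypothesis `hval` and degree hypothesis `hdeg` depend on `(ℓ, a)` ONLY.

Road FP's table has the SAME continuum parts as an3's realised free table `SquareTable.bfP/bfQ` (so `hdeg_bf`/`hval_bf`
transfer verbatim) but DIFFERENT lattice legs: the infinite-volume PERFECT legs, whose deviation from the continuum germ is the
perfect-propagator germ bound (leaf N7a, an input here: `herr`).  This file is the bookkeeping: `releg L f B herr` replaces the
lattice leg of `L` keeping `(ℓ, a, A)`; `contBubble`, `hdeg`, `hval` are invariant; specialisation to an3's table.

[our object] / [folklore] throughout.  HONEST FRAMING: bookkeeping toward `hident` (GAPS O-asym1-7); discharges nothing of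
`BetaPertH`; NOT the continuum limit, NOT Clay.
-/

namespace Summit.QuantumFields.BalabanUV.Beta.FP.PerfectLegTable

open Finset
open Literature.MathematicalPhysics.QuantumFieldTheory.Balaban1983to89
open Literature.MathematicalPhysics.QuantumFieldTheory.Balaban1983to89.Beta
open Literature.MathematicalPhysics.QuantumFieldTheory.Balaban1983to89.Beta.TransverseStructure (E4)
open Literature.MathematicalPhysics.QuantumFieldTheory.Balaban1983to89.Beta.LeadingCoefficient (leadingIntegrand kappaBal)
open Literature.MathematicalPhysics.QuantumFieldTheory.Balaban1983to89.Beta.DyadicShell (Pt toReal supNorm)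
open Literature.MathematicalPhysics.QuantumFieldTheory.Balaban1983to89.Beta.BubbleTransfer (Leg contBubble bubbleConst)
open Literature.MathematicalPhysics.QuantumFieldTheory.Balaban1983to89.Beta.SquareTable (BfIdx bfP bfQ bfCoeff hdeg_bf hval_bf)

/-! ## §1 Re-legging one `Leg` -/

/-- [our object] **Re-legging**: keep the continuum data `(ℓ, a, A)` of `L`, replace the lattice leg by `f` with error
constant `B`, given the germ bound `herr : |f Lk k w − ℓ w| ≤ B/‖w‖^{a+1}` (`w ≠ 0`). -/
def releg (L : Leg) (f : ℕ → ℕ → Pt → ℝ) (B : ℝ) (hB : 0 ≤ B)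
    (herr : ∀ Lk k : ℕ, ∀ w : Pt, w ≠ 0 → |f Lk k w - L.ℓ (toReal w)| ≤ B / (supNorm w : ℝ) ^ (L.a + 1)) : Leg where
  f := f
  ℓ := L.ℓ
  a := L.a
  A := L.A
  B := B
  nonneg_A := L.nonneg_A
  nonneg_B := hB
  lead := L.lead
  err := herr

section One

variable (L : Leg) (f : ℕ → ℕ → Pt → ℝ) (B : ℝ) (hB : 0 ≤ B)
  (herr : ∀ Lk k : ℕ, ∀ w : Pt, w ≠ 0 → |f Lk k w - L.ℓ (toReal w)| ≤ B / (supNorm w : ℝ) ^ (L.a + 1))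

/-- [our object] the new lattice leg. -/
@[simp] theorem releg_f : (releg L f B hB herr).f = f := rfl
/-- [our object] continuum part unchanged. -/
@[simp] theorem releg_ℓ : (releg L f B hB herr).ℓ = L.ℓ := rfl
/-- [our object] degree unchanged. -/
@[simp] theorem releg_a : (releg L f B hB herr).a = L.a := rfl
/-- [our object] size constant unchanged. -/
@[simp] theorem releg_A : (releg L f B hB herr).A = L.A := rfl
/-- [our object] the new error constant. -/
@[simp] theorem releg_B : (releg L f B hB herr).B = B := rfl

end One

/-! ## §2 Re-legging a table: `contBubble`, `hdeg`, `hval` are invariant -/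

section Table

variable {ι : Type*} {s : Finset ι} {c : ι → ℝ} {P Q : ι → Leg}
  (fP fQ : ι → ℕ → ℕ → Pt → ℝ) (BP BQ : ι → ℝ) (hBP : ∀ i, 0 ≤ BP i) (hBQ : ∀ i, 0 ≤ BQ i)
  (herrP : ∀ i, ∀ Lk k : ℕ, ∀ w : Pt, w ≠ 0 → |fP i Lk k w - (P i).ℓ (toReal w)| ≤ BP i / (supNorm w : ℝ) ^ ((P i).a + 1))
  (herrQ : ∀ i, ∀ Lk k : ℕ, ∀ w : Pt, w ≠ 0 → |fQ i Lk k w - (Q i).ℓ (toReal w)| ≤ BQ i / (supNorm w : ℝ) ^ ((Q i).a + 1))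

/-- [folklore] the continuum bubble of a re-legged table is that of the original table (it depends on the `ℓ`'s only). -/
theorem contBubble_releg (x : E4) :
    contBubble s c (fun i => releg (P i) (fP i) (BP i) (hBP i) (herrP i)) (fun i => releg (Q i) (fQ i) (BQ i) (hBQ i) (herrQ i)) x
      = contBubble s c P Q x := rfl

/-- [folklore] the degree hypothesis transfers. -/
theorem hdeg_releg (hdeg : ∀ i ∈ s, (P i).a + (Q i).a = 6) :
    ∀ i ∈ s, (releg (P i) (fP i) (BP i) (hBP i) (herrP i)).a + (releg (Q i) (fQ i) (BQ i) (hBQ i) (herrQ i)).a = 6 :=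
  hdeg

/-- [folklore] the value hypothesis transfers. -/
theorem hval_releg {μ ν : Fin 4} {N : ℝ}
    (hval : ∀ x : E4, x ≠ 0 → x μ * x ν * contBubble s c P Q x = leadingIntegrand (kappaBal N) μ ν x) :
    ∀ x : E4, x ≠ 0 → x μ * x ν *
      contBubble s c (fun i => releg (P i) (fP i) (BP i) (hBP i) (herrP i)) (fun i => releg (Q i) (fQ i) (BQ i) (hBQ i) (herrQ i)) x
        = leadingIntegrand (kappaBal N) μ ν x :=
  hval

/-- [folklore] the transfer constant of the re-legged table, in closed form (the `A`'s of the original table, the new `B`'s). -/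
theorem bubbleConst_releg :
    bubbleConst s c (fun i => releg (P i) (fP i) (BP i) (hBP i) (herrP i)) (fun i => releg (Q i) (fQ i) (BQ i) (hBQ i) (herrQ i))
      = ∑ i ∈ s, |c i| * (BP i * ((Q i).A + BQ i) + (P i).A * BQ i) := rfl

end Table

/-! ## §3 The perfect table over an3's continuum data (`SquareTable.bfP/bfQ`, coefficients `bfCoeff N`) -/

section Perfect

variable {μ ν : Fin 4} (hμν : μ ≠ ν)
  (fP fQ : BfIdx → ℕ → ℕ → Pt → ℝ) (BP BQ : BfIdx → ℝ) (hBP : ∀ i, 0 ≤ BP i) (hBQ : ∀ i, 0 ≤ BQ i)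
  (herrP : ∀ i, ∀ Lk k : ℕ, ∀ w : Pt, w ≠ 0 →
    |fP i Lk k w - (bfP hμν i).ℓ (toReal w)| ≤ BP i / (supNorm w : ℝ) ^ ((bfP hμν i).a + 1))
  (herrQ : ∀ i, ∀ Lk k : ℕ, ∀ w : Pt, w ≠ 0 →
    |fQ i Lk k w - (bfQ hμν i).ℓ (toReal w)| ≤ BQ i / (supNorm w : ℝ) ^ ((bfQ hμν i).a + 1))

/-- [our object] **the perfect table, first legs**: an3's continuum data `bfP hμν`, lattice legs `fP` (the infinite-volume perfect
legs, supplied with their germ bounds `herrP` by leaf N7a). -/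
noncomputable def perfP : BfIdx → Leg := fun i => releg (bfP hμν i) (fP i) (BP i) (hBP i) (herrP i)

/-- [our object] **the perfect table, second legs**. -/
noncomputable def perfQ : BfIdx → Leg := fun i => releg (bfQ hμν i) (fQ i) (BQ i) (hBQ i) (herrQ i)

/-- [folklore] **`hdeg` for the perfect table** = an3's `hdeg_bf`. -/
theorem hdeg_perf : ∀ i ∈ (Finset.univ : Finset BfIdx),
    (perfP hμν fP BP hBP herrP i).a + (perfQ hμν fQ BQ hBQ herrQ i).a = 6 :=
  hdeg_bf hμν

/-- [folklore] **`hval` for the perfect table** = an3's `hval_bf`: the continuum bubble is `leadingIntegrand (kappaBal N)`. -/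
theorem hval_perf (N : ℝ) : ∀ x : E4, x ≠ 0 →
    x μ * x ν * contBubble Finset.univ (bfCoeff N) (perfP hμν fP BP hBP herrP) (perfQ hμν fQ BQ hBQ herrQ) x
      = leadingIntegrand (kappaBal N) μ ν x :=
  hval_bf hμν N

/-- [our object] the lattice legs of the perfect table are the supplied perfect legs. -/
@[simp] theorem perfP_f (i : BfIdx) : (perfP hμν fP BP hBP herrP i).f = fP i := rfl

/-- [our object] idem, second legs. -/
@[simp] theorem perfQ_f (i : BfIdx) : (perfQ hμν fQ BQ hBQ herrQ i).f = fQ i := rfl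

/-- [our object] degrees of the perfect table are an3's. -/
@[simp] theorem perfP_a (i : BfIdx) : (perfP hμν fP BP hBP herrP i).a = (bfP hμν i).a := rfl

/-- [our object] idem, second legs. -/
@[simp] theorem perfQ_a (i : BfIdx) : (perfQ hμν fQ BQ hBQ herrQ i).a = (bfQ hμν i).a := rfl

end Perfect

end Summit.QuantumFields.BalabanUV.Beta.FP.PerfectLegTable
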